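import Mathlib
import Summits.Ventures.PercRepro2.Defs
import Summits.Ventures.PercRepro2.Independence
import Summits.Ventures.PercRepro2.Harris
import Summits.Ventures.PercRepro2.Graph
import Summits.Ventures.PercRepro2.Events
import Summits.Ventures.PercRepro2.BoxUnionDefs
import Summits.Ventures.PercRepro2.BoxUnion
import Summits.Ventures.PercRepro2.BoxUnionPair
import Summits.Ventures.PercRepro2.BoxUnionPush

/-!
# Down-closure between observed sets (blind cell PercRepro2, mine-1 g38; the precision note of
ref-1 on MINE1-ZLSM.md §6.1)

`BoxUnionPush.lean` gives down-closure FROM THE FULL LAW (`pairLaw_lsm_of_univ`). The same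
argument between two observed sets `F' ⊆ F`: the status law on `F'` is the image of the status
law on `F` under `restrictZ F'` (`pairLaw_eq_pushforward_of_subset`), so it inherits
log-supermodularity (`pairLaw_lsm_of_subset`) — the class of observed sets on which the status
law is log-supermodular is closed downwards.
-/

namespace Summit.Ventures.PercRepro2

namespace BoxUnionPair

open Finset
open scoped Classical

variable {V : Type*} {E : Type*} [Fintype V] [DecidableEq V] [Fintype E] [DecidableEq E]

omit [DecidableEq E] in
/-- For `F' ⊆ F` the status on `F'` is the restriction of the status on `F`. -/
lemma status_eq_restrictZ_of_subset (ends : E → Sym2 V) {F F' : Finset V} (h : F' ⊆ F)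
    (s t : V) (ω : Config E) :
    status ends F' s t ω = restrictZ F' (status ends F s t ω) := by
  unfold status restrictZ
  refine Prod.ext ?_ ?_
  · simp only
    rw [Finset.filter_inter, Finset.inter_eq_right.mpr h]
  · simp only
    change OrderDual.toDual (F'.filter (fun u => Conn ends ω t u)) =
      OrderDual.toDual (F.filter (fun u => Conn ends ω t u) ∩ F')
    rw [Finset.filter_inter, Finset.inter_eq_right.mpr h]

variable {p : E → ℝ} (ends : E → Sym2 V) {F F' : Finset V} (s t : V)

/-- The status law on `F' ⊆ F` is the image of the status law on `F` under `restrictZ F'`. -/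
lemma pairLaw_eq_pushforward_of_subset (h : F' ⊆ F) (k : ZLat V) :
    pairLaw p ends F' s t k = pushforward (restrictZ F') (pairLaw p ends F s t) k := by
  unfold pushforward pairLaw
  have hpush : ∀ x : ZLat V,
      (if restrictZ F' x = k then
        ∑ ω, (if status ends F s t ω = x ∧ ω ∈ (connEvent ends s t)ᶜ then weight p ω else 0)
      else 0) =
      ∑ ω, if restrictZ F' x = k ∧ status ends F s t ω = x ∧ ω ∈ (connEvent ends s t)ᶜ then
        weight p ω else 0 := by
    intro x
    split_ifs with hx
    · refine Finset.sum_congr rfl fun ω _ => ?_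
      simp only [hx, true_and]
    · simp only [hx, false_and, if_false, Finset.sum_const_zero]
  rw [Finset.sum_congr rfl fun x _ => hpush x, Finset.sum_comm]
  refine Finset.sum_congr rfl fun ω _ => ?_
  rw [status_eq_restrictZ_of_subset ends h]
  by_cases hQ : ω ∈ (connEvent ends s t)ᶜ
  · simp only [hQ, and_true]
    rw [Finset.sum_eq_single (status ends F s t ω)]
    · simp only [and_true]
    · intro x _ hx
      rw [if_neg (fun h => hx h.2.symm)]
    · intro h
      exact absurd (Finset.mem_univ _) h
  · simp only [hQ, and_false, if_false, Finset.sum_const_zero]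

/-- **Down-closure between observed sets.** If the status law on `F` is log-supermodular, so is
the status law on every `F' ⊆ F`. -/
theorem pairLaw_lsm_of_subset (hp : IsProbVec p) (h : F' ⊆ F)
    (hlsm : ∀ x y : ZLat V, pairLaw p ends F s t x * pairLaw p ends F s t y ≤
      pairLaw p ends F s t (x ⊓ y) * pairLaw p ends F s t (x ⊔ y)) (x y : ZLat V) :
    pairLaw p ends F' s t x * pairLaw p ends F' s t y ≤
      pairLaw p ends F' s t (x ⊓ y) * pairLaw p ends F' s t (x ⊔ y) := by
  simp only [pairLaw_eq_pushforward_of_subset ends s t h]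
  exact pushforward_lsm (restrictZ_inf F') (restrictZ_sup F') (pairLaw_nonneg ends F s t hp) hlsm x y

end BoxUnionPair

end Summit.Ventures.PercRepro2
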